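import Summits.NavierStokesRegularity.NavierStokesRegularity.Theorems.SymmetricScarExists.Negative.SpiralWorld
import Summits.NavierStokesRegularity.NavierStokesRegularity.Theorems.SymmetricScarExists.Negative.LocalTypeIBarrier
import Literature.Analysis.FluidPDE.KNSSLiouville

/-!
# `SymmetricScarExists` (crux stmt-NavierStokesRegularity-11718, route RellichScar): bridge from the
# spiral world to the tree's Type-I RDSS Liouville wall — negative-side support, part 5 (cdisprove seat)

Continuation of `Negative/SpiralWorld.lean`.  The conditional refutation
`not_symmetricScarExists_of_spiral_world` lives in a world of rotated self-similar (RSS) Type-I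
profiles (Perelman's ansatz; Pineau–Vicol 2026 Conj. 1.1).  This file ties that world to the tree's
vocabulary for the Tsai–Perelman wall (`IsRotatedDSS`, `RotatedTypeIDSSLiouville`,
`SelfSimilarLiouville.lean`; Bradshaw–Tsai 2017 OP 5.1, Tsai GSM 192 Conj. 8.8–8.9):

* `rotZIso θ : ℝ³ ≃ₗᵢ[ℝ] ℝ³` — the rotation about `e₃` as a linear isometric equivalence;
* `IsSpiralRSSGlobal α u` — the all-time RSS identity (the P–V ansatz field has it,
  `isSpiralRSSGlobal_pvAnsatz`; it restricts to `IsSpiralRSS`);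
* `IsSpiralRSSGlobal.isRotatedDSS` — RSS ⊆ RDSS in group form: an all-time `α`-RSS field is
  `IsRotatedDSS λ (rotZIso (−2α log λ))` for EVERY `λ > 0` (P–V Remark 1.5 / §1.4);
* `slices_ae_zero_of_rdss_wall`, `not_isBackwardSingularPoint_of_slices_ae_zero`,
  `no_rss_singular_apex_profile_of_rdss_wall` — under `∀ c R, RotatedTypeIDSSLiouville c R` (the
  OPEN wall) no singular apex profile is an all-time `α`-RSS ancient mild solution with measurable
  slices: the spiral world is exactly as empty as the wall says, no emptier — in that direction the
  crux's fate IS the Tsai–Perelman wall.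

## References

* B. Pineau, V. Vicol, arXiv:2607.09619 (2026): §1.2–1.4, Conjecture 1.1, Remark 1.5. [PineauVicol2026]
* Z. Bradshaw, T.-P. Tsai, Comm. PDE 42 (2017), §5 Open Problem 5.1. [BradshawTsai2017CPDE]
* D. Chae, J. Wolf, Comm. PDE 42 (2017) = arXiv:1610.09464, Def. 1.1. [ChaeWolf2017RemovingDSS]
-/

noncomputable section

open MeasureTheory Set Function Filter Topology TopologicalSpace Metric
open scoped NNReal ENNReal

namespace Summit.NavierStokesRegularity.NavierStokesRegularity.Theorems.SymmetricScarExists.Negative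

open Literature.Analysis.FluidPDE
open Summit.NavierStokesRegularity.NavierStokesRegularity.Theses.RellichScar

variable {u : ℝ → EuclideanSpace ℝ (Fin 3) → EuclideanSpace ℝ (Fin 3)}

/-! ### Bridge to the tree's Type-I RDSS Liouville wall (`RotatedTypeIDSSLiouville`, Tsai–Perelman) -/

/-- Rotation about `e₃` as a linear isometric equivalence (light-import twin of the tree's
`rotZLIE`). -/
def rotZIso (θ : ℝ) : (EuclideanSpace ℝ (Fin 3)) ≃ₗᵢ[ℝ] (EuclideanSpace ℝ (Fin 3)) where
  toFun := rotZ θ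
  invFun := rotZ (-θ)
  map_add' x y := by
    ext i
    fin_cases i <;> simp <;> ring
  map_smul' a x := by simp [rotZ_smul']
  left_inv x := by
    show rotZ (-θ) (rotZ θ x) = x
    rw [← rotZ_add, neg_add_cancel, rotZ_zero]
  right_inv x := by
    show rotZ θ (rotZ (-θ) x) = x
    rw [← rotZ_add, add_neg_cancel, rotZ_zero]
  norm_map' := norm_rotZ θ

/-- `rotZIso θ` acts as `R_θ`. [folklore] -/
@[simp] theorem rotZIso_apply (θ : ℝ) (x : (EuclideanSpace ℝ (Fin 3))) : rotZIso θ x = rotZ θ x := rfl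

/-- Its inverse acts as `R_{−θ}`. [folklore] -/
@[simp] theorem rotZIso_symm_apply (θ : ℝ) (x : (EuclideanSpace ℝ (Fin 3))) : (rotZIso θ).symm x = rotZ (-θ) x := rfl

/-- All-time form of the RSS identity (for the Pineau–Vicol ansatz field both sides vanish for
`t ≥ 0`, `isSpiralRSSGlobal_pvAnsatz`); this is the form the tree's `IsRotatedDSS` (all `t`) wants. -/
def IsSpiralRSSGlobal (α : ℝ) (u : ℝ → (EuclideanSpace ℝ (Fin 3)) → (EuclideanSpace ℝ (Fin 3))) : Prop :=
  ∀ θ t : ℝ, ∀ x : (EuclideanSpace ℝ (Fin 3)), nsRescale (Real.exp (-θ / (2 * α))) u t x = conjZ θ u t x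

/-- The all-time identity restricts to the `t < 0` one. [folklore] -/
theorem IsSpiralRSSGlobal.isSpiralRSS {α : ℝ} (h : IsSpiralRSSGlobal α u) : IsSpiralRSS α u :=
  fun θ t _ x => h θ t x

/-- The Pineau–Vicol ansatz field is RSS at all times (junk `0` for `t ≥ 0` on both sides).
[cite: PineauVicol2026, (1.7) (arXiv:2607.09619 p. 3)] -/
theorem isSpiralRSSGlobal_pvAnsatz {α : ℝ} (hα : α ≠ 0) (U : (EuclideanSpace ℝ (Fin 3)) → (EuclideanSpace ℝ (Fin 3))) :
    IsSpiralRSSGlobal α (pvAnsatz α (fun y _ => U y)) := by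
  intro θ t x
  by_cases ht : t < 0
  · exact isSpiralRSS_pvAnsatz hα U θ t ht x
  · push Not at ht
    have hct : 0 ≤ Real.exp (-θ / (2 * α)) ^ 2 * t := mul_nonneg (sq_nonneg _) ht
    have h1 : Real.sqrt (-(Real.exp (-θ / (2 * α)) ^ 2 * t)) = 0 :=
      Real.sqrt_eq_zero'.2 (by linarith)
    have h2 : Real.sqrt (-t) = 0 := Real.sqrt_eq_zero'.2 (by linarith)
    have h0 : rotZ θ (0 : EuclideanSpace ℝ (Fin 3)) = 0 := by
      simpa using rotZ_smul' θ 0 (0 : EuclideanSpace ℝ (Fin 3))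
    simp [conjZ, nsRescale_apply, pvAnsatz, h1, h2, h0]

/-- **RSS ⊆ RDSS, group form**: an all-time `α`-RSS field is rotated discretely self-similar in
the tree's sense `IsRotatedDSS λ (R_{−2α log λ})` for EVERY factor `λ > 0`
(Pineau–Vicol 2026, Remark 1.5 / §1.4; Chae–Wolf 2017, Def. 1.1). [cite: PineauVicol2026, §1.4 (arXiv:2607.09619 pp. 6–7)] -/
theorem IsSpiralRSSGlobal.isRotatedDSS {α : ℝ} (hα : α ≠ 0) (h : IsSpiralRSSGlobal α u)
    {lam : ℝ} (hlam : 0 < lam) :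
    IsRotatedDSS lam (rotZIso (-(2 * α * Real.log lam))) u := by
  intro t x
  set θ : ℝ := -(2 * α * Real.log lam) with hθ
  have hlam' : Real.exp (-θ / (2 * α)) = lam := by
    rw [hθ, show -(-(2 * α * Real.log lam)) / (2 * α) = Real.log lam by field_simp, Real.exp_log hlam]
  have key := h θ t (rotZ θ x)
  rw [hlam'] at key
  simp only [nsRescale_apply, conjZ] at key
  rw [← rotZ_add, neg_add_cancel, rotZ_zero] at key
  simp only [rotZIso_apply, rotZIso_symm_apply]
  rw [← rotZ_smul', key, ← rotZ_add, neg_add_cancel, rotZ_zero]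

/-- **The RDSS wall empties the spiral world.**  If the tree's rotated Type-I DSS Liouville
statements `RotatedTypeIDSSLiouville c R` hold for all `c`, `R` (the OPEN Tsai–Perelman wall,
`TypeIDSSLiouvilleConjecture`), then every all-time `α`-RSS ancient mild solution with measurable
slices and a Type-I bound vanishes slice-wise (apply the wall with `c = e`, `R = R_{−2α}`).
[cite: PineauVicol2026, Conjecture 1.1; BradshawTsai2017CPDE, §5 OP 5.1] -/
theorem slices_ae_zero_of_rdss_wall {α : ℝ} (hα : α ≠ 0)
    (hwall : ∀ (c : ℝ) (R : (EuclideanSpace ℝ (Fin 3)) ≃ₗᵢ[ℝ] (EuclideanSpace ℝ (Fin 3))), RotatedTypeIDSSLiouville c R)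
    (hmild : Literature.Analysis.FluidPDE.IsAncientMildSolution 1 u)
    (hmeas : ∀ t < 0, AEStronglyMeasurable (u t) volume) (h : IsSpiralRSSGlobal α u) {C : ℝ}
    (hdec : HasTypeIDecay C u) : ∀ t < 0, u t =ᵐ[volume] 0 :=
  hwall (Real.exp 1) (rotZIso (-(2 * α * Real.log (Real.exp 1)))) (Real.one_lt_exp_iff.2 one_pos) u
    hmild hmeas (h.isRotatedDSS hα (Real.exp_pos 1)) ⟨C, hdec⟩

/-- Slice-wise vanishing excludes a backward-singular origin (Tonelli glue, tree
`ae_eq_zero_slab_of_ae_slice`). [folklore] -/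
theorem not_isBackwardSingularPoint_of_slices_ae_zero {G : ℝ → (EuclideanSpace ℝ (Fin 3)) → (EuclideanSpace ℝ (Fin 3)) →L[ℝ] (EuclideanSpace ℝ (Fin 3))}
    (hwg : HasWeakSpatialGradientOn (slab (EuclideanSpace ℝ (Fin 3)) (Iio (0 : ℝ)) isOpen_Iio) u G) (h0 : ∀ t < 0, u t =ᵐ[volume] 0) :
    ¬ IsBackwardSingularPoint u 0 := by
  intro hs
  have hjoint : AEStronglyMeasurable (uncurry u)
      (volume.restrict (Iio (0 : ℝ) ×ˢ (univ : Set (EuclideanSpace ℝ (Fin 3))))) :=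
    hwg.locallyIntegrableOn.aestronglyMeasurable
  have hslice : ∀ᵐ t ∂(volume.restrict (Iio (0 : ℝ))), u t =ᵐ[volume] 0 :=
    (ae_restrict_mem measurableSet_Iio).mono fun t ht => h0 t ht
  have hz := ae_eq_zero_slab_of_ae_slice hjoint hslice
  have hz' : ∀ᵐ z ∂(volume.restrict (parabolicCylinder 1 (0 : ℝ × (EuclideanSpace ℝ (Fin 3))))), uncurry u z = (0 : ℝ × (EuclideanSpace ℝ (Fin 3)) → (EuclideanSpace ℝ (Fin 3))) z :=
    ae_restrict_of_ae_restrict_of_subset (parabolicCylinder_subset_lowerHalf le_rfl 1) hz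
  have h1 := hs 1 one_pos
  rw [eLpNorm_congr_ae hz', eLpNorm_zero] at h1
  exact ENNReal.zero_ne_top h1

/-- **Summary**: under the (open) RDSS wall there is no singular apex profile which is an all-time
`α`-RSS ancient mild solution with measurable slices — the spiral world of
`not_symmetricScarExists_of_spiral_world` is exactly as empty as the Tsai–Perelman wall says, no
emptier: the crux's fate in that direction IS the wall. [cite: PineauVicol2026, Conjecture 1.1] -/
theorem no_rss_singular_apex_profile_of_rdss_wall {α : ℝ} (hα : α ≠ 0)
    (hwall : ∀ (c : ℝ) (R : (EuclideanSpace ℝ (Fin 3)) ≃ₗᵢ[ℝ] (EuclideanSpace ℝ (Fin 3))), RotatedTypeIDSSLiouville c R)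
    {G : ℝ → (EuclideanSpace ℝ (Fin 3)) → (EuclideanSpace ℝ (Fin 3)) →L[ℝ] (EuclideanSpace ℝ (Fin 3))} {C : ℝ}
    (hwg : HasWeakSpatialGradientOn (slab (EuclideanSpace ℝ (Fin 3)) (Iio (0 : ℝ)) isOpen_Iio) u G) (hdec : HasTypeIDecay C u)
    (hmild : Literature.Analysis.FluidPDE.IsAncientMildSolution 1 u)
    (hmeas : ∀ t < 0, AEStronglyMeasurable (u t) volume) (h : IsSpiralRSSGlobal α u) :
    ¬ IsBackwardSingularPoint u 0 :=
  not_isBackwardSingularPoint_of_slices_ae_zero hwg (slices_ae_zero_of_rdss_wall hα hwall hmild hmeas h hdec)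


end Summit.NavierStokesRegularity.NavierStokesRegularity.Theorems.SymmetricScarExists.Negative
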